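import Literature.MathematicalPhysics.QuantumManyBody.SwapPurity
import Mathlib.Analysis.SpecialFunctions.Log.Basic
import Mathlib.Analysis.Real.Sqrt
import HarnessLib

/-!
# Accessible swap mass and swap (teleportation) relative entropy of a real wave function

Topic `Literature/MathematicalPhysics/QuantumManyBody`; definition request `defn-swapEntropy` (route
`BECInsertionVariance` of the conjunct `BoseEinsteinCondensation` of `AtomisticToContinuum`, items
`InsertionEntropyBound` / `EntropyFromStructure` / `TruncatedSwapJensen` / `GroundStateAccessible`,
which inline the terms verbatim with `let p … let q …`). Hygiene companion of
`Literature.MathematicalPhysics.QuantumManyBody.BoseGas.swapPurity` (`SwapPurity.lean`).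

Take a real function `Φ` on `(ℝ³)^{n+1}` (a real `N = n + 1`-boson wave function, e.g. the
nonnegative Dirichlet ground state) and TWO INDEPENDENT REPLICAS `Z = (X, Y)` of the configuration.
The **replica swap** `T (X, Y) = (X[0 ↦ y₀], Y[0 ↦ x₀])` exchanges particle `0` between the replicas
(`replicaSwap`; the `n = 1` particle-partition permutation operator `Π₂^A`, `A = {0}`, of
Herdman–Roy–Melko–Del Maestro on the doubled configuration space
`|R_A, R_B ; R̃_Ã, R̃_B̃⟩ ↦ |R̃_Ã, R_B ; R_A, R̃_B̃⟩`, [HerdmanEtAl2014, §"Particle entanglement and Rényi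
entropies", eq. (1)]); it is a measure-preserving involution (`measurePreserving_replicaSwap`).
With the two-replica density and its image under the swap,

  `p (X, Y) = Φ(X)² Φ(Y)²` (`replicaDensity`),  `q = p ∘ T` (`swappedDensity`),

the swap purity is the Bhattacharyya affinity `swapPurity n Φ = ∫ √(p q) = tr(γ_Φ²)/N²`
(`swapPurity_ofReal_eq_lintegral_sqrt`, from `swapPurity_eq_lintegral_of_nonneg`: the two-replica
expectation `⟨Ψ ⊗ Ψ| Π₂^A |Ψ ⊗ Ψ⟩ = e^{-S₂}` of [HerdmanEtAl2014, eq. (1)] written out for a real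
nonnegative `Ψ`), and the route's two scalar functionals of `Φ` are

* `swapMass n Φ = ∫_{q ≠ 0} p = P_p(q ≠ 0)` — the **accessible swap mass**: the `p`-probability that
  the swapped configuration is still allowed (`q ≠ 0`; e.g. the teleported particle does not land in
  a hard core or outside the box);
* `swapEntropy n Φ = ∫_{q ≠ 0} (p (log p − log q))⁺ = ∫_{q ≠ 0} p (log p − log q)⁺` — the
  **accessible swap (teleportation) relative entropy**: the Kullback–Leibler integrand of `p`
  relative to `q`, positive part, on the accessible set (`ENNReal.ofReal` truncates the negative
  part; `Real.log 0 = 0` is never met on `{q ≠ 0} ∩ {p ≠ 0}` and contributes `0` on `{p = 0}`). In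
  the ratio form `q/p = e^{-(ΔU)}` it is the `p`-mean of the positive part of the excess "insertion
  work" `ΔU = log p − log q` of moving one boson of each replica to the position of its twin;
  `q/p` is the weight ratio (permuted : identity configuration) that the replica Monte Carlo
  estimator of `e^{-S₂}` samples [HerdmanEtAl2014, eq. (2)].

Both are functionals introduced by the route (no published source states results about them; the
tags are `[folklore]`); only the exchange `T` and the identity `swapPurity = ⟨Π₂^A⟩` are Herdman
et al.'s.

API: unfolding lemmas literally matching the inlined route terms (`swapMass_def`, `swapEntropy_def`,
by `rfl`); measurability of `p`, `q`, `T`, `{q ≠ 0}`; `T` is a measure-preserving involution, so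
`∫ q = ∫ p = (∫ Φ²)²`; `swapMass ≤ (∫ Φ²)² ≤ 1`; `q = p` (e.g. Hartree product states
`Φ = ∏ᵢ φ(xᵢ)`, `swappedDensity_prod`) gives `swapEntropy = 0` and `swapMass = ∫∫ p`; the
Bhattacharyya form of `swapPurity` in terms of `p`, `q`, also restricted to `{q ≠ 0}`.

Mathlib has the Kullback–Leibler divergence of two MEASURES (`InformationTheory.klDiv`), not this
truncated set-restricted functional of a wave function, and no replica/permutation operators; the
coordinate-permutation transport (`MeasurableEquiv.piCongrLeft`, `MeasurableEquiv.sumPiEquivProdPi`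
and their `volume_measurePreserving_*`) is Mathlib's.

## References

* [HerdmanEtAl2014] C. M. Herdman, P.-N. Roy, R. G. Melko, A. Del Maestro, *Particle entanglement
  in continuum many-body systems via quantum Monte Carlo*, Phys. Rev. B 89 (2014) 140501(R),
  doi:10.1103/PhysRevB.89.140501, arXiv:1310.8332: the permutation operator `Π₂^A` on two replicas,
  `⟨Ψ,Ψ̃|Π₂^A|Ψ,Ψ̃⟩ = e^{-S₂}` (eq. (1)) and its path-weight-ratio estimator (eq. (2)).
* [PenroseOnsager1956] O. Penrose, L. Onsager, *Bose–Einstein condensation and liquid helium*,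
  Phys. Rev. 104 (1956) 576–584: §4 (5)–(7) (`tr σ₁²`, see `SwapPurity.lean`).
* [Reatto1969] L. Reatto, *Bose–Einstein condensation for a class of wave functions*, Phys. Rev.
  183 (1969) 334–338 (condensate of pair-product states via the classical-fluid analogy; context
  for the insertion-work reading, not used formally).
-/

noncomputable section

open MeasureTheory
open scoped ENNReal NNReal ComplexConjugate

namespace Literature.MathematicalPhysics.QuantumManyBody.BoseGas

variable {n : ℕ}

/-! ### Two replicas and the exchange of particle `0` -/

/-- The **replica swap** `T (X, Y) = (X[0 ↦ y₀], Y[0 ↦ x₀])` on two copies of the `N = n + 1`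
particle configuration space: exchange of particle `0` between the replicas (the permutation
operator `Π₂^A` for the one-particle subset `A = {0}`).
[cite: HerdmanEtAl2014, §"Particle entanglement and Rényi entropies", Π₂^A before eq. (1)] -/
def replicaSwap (Z : Config (n + 1) × Config (n + 1)) : Config (n + 1) × Config (n + 1) :=
  (Function.update Z.1 0 (Z.2 0), Function.update Z.2 0 (Z.1 0))

/-- The **two-replica density** `p (X, Y) = Φ(X)² Φ(Y)²` of a real wave function `Φ` (the density
`|Ψ ⊗ Ψ̃|²` of the doubled system of Herdman et al. for real `Ψ = Ψ̃ = Φ`). [folklore] -/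
def replicaDensity (Φ : Config (n + 1) → ℝ) (Z : Config (n + 1) × Config (n + 1)) : ℝ :=
  Φ Z.1 ^ 2 * Φ Z.2 ^ 2

/-- The **swapped two-replica density** `q (X, Y) = Φ(X[0 ↦ y₀])² Φ(Y[0 ↦ x₀])² = p (T (X, Y))`
(`replicaDensity_replicaSwap`): the weight of the doubled configuration with particle `0`
exchanged between the replicas (`T = replicaSwap`, the `n = 1` permutation operator of Herdman
et al.). [folklore] -/
def swappedDensity (Φ : Config (n + 1) → ℝ) (Z : Config (n + 1) × Config (n + 1)) : ℝ :=
  Φ (Function.update Z.1 0 (Z.2 0)) ^ 2 * Φ (Function.update Z.2 0 (Z.1 0)) ^ 2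

/-- The **accessible swap mass** `swapMass n Φ = ∫_{q ≠ 0} p = P_p(q ≠ 0) ∈ [0, ∞]` of a real wave
function `Φ` of `n + 1` particles: the two-replica probability (weight `p = Φ² ⊗ Φ²`) that
exchanging particle `0` between the replicas (the `n = 1` permutation operator of Herdman et al.,
`replicaSwap`) gives an allowed configuration (`q ≠ 0`). For normalised `Φ` it is at most `1`
(`swapMass_le_one`); it equals `∫∫ p` when `q = p` (`swapMass_eq_lintegral_of_swappedDensity_eq`).
A functional introduced by route `BECInsertionVariance` (hygiene definition, no published
source asserts anything about it). [folklore] -/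
def swapMass (n : ℕ) (Φ : Config (n + 1) → ℝ) : ℝ≥0∞ :=
  ∫⁻ Z in {Z | swappedDensity Φ Z ≠ 0}, ENNReal.ofReal (replicaDensity Φ Z)

/-- The **accessible swap (teleportation) relative entropy**
`swapEntropy n Φ = ∫_{q ≠ 0} (p (log p − log q))⁺ ∈ [0, ∞]` of a real wave function `Φ` of `n + 1`
particles: the positive part of the Kullback–Leibler integrand of the two-replica density
`p = Φ² ⊗ Φ²` relative to its image `q = p ∘ T` under the exchange of particle `0` between the
replicas (`T = replicaSwap`, the `n = 1` permutation operator of Herdman et al.), integrated over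
the accessible set `{q ≠ 0}` (`ENNReal.ofReal` truncates at `0`; with Lean's `Real.log 0 = 0` the
integrand vanishes where `p = 0`, matching `0 · log 0 = 0`). Equivalently
`∫_{q ≠ 0} p · (log p − log q)⁺` (`swapEntropy_eq_lintegral_mul`). Vanishes when `q = p`
(`swapEntropy_eq_zero_of_swappedDensity_eq`, e.g. product states, `swapEntropy_prod`).
A functional introduced by route `BECInsertionVariance` (hygiene definition, no published
source asserts anything about it). [folklore] -/
def swapEntropy (n : ℕ) (Φ : Config (n + 1) → ℝ) : ℝ≥0∞ :=
  ∫⁻ Z in {Z | swappedDensity Φ Z ≠ 0},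
    ENNReal.ofReal (replicaDensity Φ Z *
      (Real.log (replicaDensity Φ Z) - Real.log (swappedDensity Φ Z)))

/-! ### Unfolding lemmas (the forms inlined with `let p … let q …` in the route items) -/

/-- `p` as the lambda inlined in the route items. [folklore] -/
theorem replicaDensity_eq (Φ : Config (n + 1) → ℝ) :
    replicaDensity Φ = fun Z => Φ Z.1 ^ 2 * Φ Z.2 ^ 2 :=
  rfl

/-- `q` as the lambda inlined in the route items. [folklore] -/
theorem swappedDensity_eq (Φ : Config (n + 1) → ℝ) :
    swappedDensity Φ = fun Z =>
      Φ (Function.update Z.1 0 (Z.2 0)) ^ 2 * Φ (Function.update Z.2 0 (Z.1 0)) ^ 2 :=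
  rfl

/-- Unfolding `swapMass` to the term inlined in the route items (there written with `p`, `q`
`let`-bound: `∫⁻ Z in {Z | q Z ≠ 0}, ENNReal.ofReal (p Z)`, the same term up to `ζ`-reduction, so
`show swapMass n Φ ≤ _` / `change` work on such hypotheses). [folklore] -/
theorem swapMass_def (n : ℕ) (Φ : Config (n + 1) → ℝ) :
    swapMass n Φ = ∫⁻ Z in {Z : Config (n + 1) × Config (n + 1) |
        Φ (Function.update Z.1 0 (Z.2 0)) ^ 2 * Φ (Function.update Z.2 0 (Z.1 0)) ^ 2 ≠ 0},
      ENNReal.ofReal (Φ Z.1 ^ 2 * Φ Z.2 ^ 2) :=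
  rfl

/-- Unfolding `swapEntropy` to the term inlined in the route items (there written with `p`, `q`
`let`-bound: `∫⁻ Z in {Z | q Z ≠ 0}, ENNReal.ofReal (p Z * (Real.log (p Z) - Real.log (q Z)))`,
the same term up to `ζ`-reduction). [folklore] -/
theorem swapEntropy_def (n : ℕ) (Φ : Config (n + 1) → ℝ) :
    swapEntropy n Φ = ∫⁻ Z in {Z : Config (n + 1) × Config (n + 1) |
        Φ (Function.update Z.1 0 (Z.2 0)) ^ 2 * Φ (Function.update Z.2 0 (Z.1 0)) ^ 2 ≠ 0},
      ENNReal.ofReal (Φ Z.1 ^ 2 * Φ Z.2 ^ 2 *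
        (Real.log (Φ Z.1 ^ 2 * Φ Z.2 ^ 2) -
          Real.log (Φ (Function.update Z.1 0 (Z.2 0)) ^ 2 *
            Φ (Function.update Z.2 0 (Z.1 0)) ^ 2))) :=
  rfl

/-! ### The replica swap: involution, measurability, measure preservation -/

/-- First replica after the swap: `X[0 ↦ y₀]`. [folklore] -/
@[simp]
theorem replicaSwap_fst (Z : Config (n + 1) × Config (n + 1)) :
    (replicaSwap Z).1 = Function.update Z.1 0 (Z.2 0) :=
  rfl

/-- Second replica after the swap: `Y[0 ↦ x₀]`. [folklore] -/
@[simp]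
theorem replicaSwap_snd (Z : Config (n + 1) × Config (n + 1)) :
    (replicaSwap Z).2 = Function.update Z.2 0 (Z.1 0) :=
  rfl

/-- The replica swap is an involution. [folklore] -/
@[simp]
theorem replicaSwap_replicaSwap (Z : Config (n + 1) × Config (n + 1)) :
    replicaSwap (replicaSwap Z) = Z := by
  refine Prod.ext (funext fun i => ?_) (funext fun i => ?_) <;>
    rcases eq_or_ne i 0 with rfl | hi <;> simp [replicaSwap, *]

/-- The replica swap is an involution (function form). [folklore] -/
theorem replicaSwap_involutive :
    Function.Involutive (replicaSwap : Config (n + 1) × Config (n + 1) → _) :=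
  replicaSwap_replicaSwap

/-- `q = p ∘ T`. [folklore] -/
@[simp]
theorem replicaDensity_replicaSwap (Φ : Config (n + 1) → ℝ) (Z : Config (n + 1) × Config (n + 1)) :
    replicaDensity Φ (replicaSwap Z) = swappedDensity Φ Z :=
  rfl

/-- `q = p ∘ T` (function form). [folklore] -/
theorem replicaDensity_comp_replicaSwap (Φ : Config (n + 1) → ℝ) :
    replicaDensity Φ ∘ replicaSwap = swappedDensity Φ :=
  rfl

/-- `p = q ∘ T`. [folklore] -/
@[simp]
theorem swappedDensity_replicaSwap (Φ : Config (n + 1) → ℝ) (Z : Config (n + 1) × Config (n + 1)) :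
    swappedDensity Φ (replicaSwap Z) = replicaDensity Φ Z := by
  rw [← replicaDensity_replicaSwap, replicaSwap_replicaSwap]

/-- `p ≥ 0`. [folklore] -/
theorem replicaDensity_nonneg (Φ : Config (n + 1) → ℝ) (Z : Config (n + 1) × Config (n + 1)) :
    0 ≤ replicaDensity Φ Z :=
  mul_nonneg (sq_nonneg _) (sq_nonneg _)

/-- `q ≥ 0`. [folklore] -/
theorem swappedDensity_nonneg (Φ : Config (n + 1) → ℝ) (Z : Config (n + 1) × Config (n + 1)) :
    0 ≤ swappedDensity Φ Z :=
  mul_nonneg (sq_nonneg _) (sq_nonneg _)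

/-- `q ≠ 0` iff both swapped amplitudes are nonzero. [folklore] -/
theorem swappedDensity_ne_zero_iff (Φ : Config (n + 1) → ℝ) (Z : Config (n + 1) × Config (n + 1)) :
    swappedDensity Φ Z ≠ 0 ↔
      Φ (Function.update Z.1 0 (Z.2 0)) ≠ 0 ∧ Φ (Function.update Z.2 0 (Z.1 0)) ≠ 0 := by
  simp [swappedDensity]

/-- `p ≠ 0` iff both amplitudes are nonzero. [folklore] -/
theorem replicaDensity_ne_zero_iff (Φ : Config (n + 1) → ℝ) (Z : Config (n + 1) × Config (n + 1)) :
    replicaDensity Φ Z ≠ 0 ↔ Φ Z.1 ≠ 0 ∧ Φ Z.2 ≠ 0 := by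
  simp [replicaDensity]

/-- The replica swap is measurable. [folklore] -/
theorem measurable_replicaSwap :
    Measurable (replicaSwap : Config (n + 1) × Config (n + 1) → _) :=
  (measurable_update'.comp (measurable_fst.prodMk ((measurable_pi_apply 0).comp measurable_snd))).prodMk
    (measurable_update'.comp (measurable_snd.prodMk ((measurable_pi_apply 0).comp measurable_fst)))

/-- `p` is measurable for measurable `Φ`. [folklore] -/
theorem measurable_replicaDensity {Φ : Config (n + 1) → ℝ} (hΦ : Measurable Φ) :
    Measurable (replicaDensity Φ) :=
  ((hΦ.comp measurable_fst).pow_const 2).mul ((hΦ.comp measurable_snd).pow_const 2)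

/-- `q` is measurable for measurable `Φ`. [folklore] -/
theorem measurable_swappedDensity {Φ : Config (n + 1) → ℝ} (hΦ : Measurable Φ) :
    Measurable (swappedDensity Φ) :=
  (measurable_replicaDensity hΦ).comp measurable_replicaSwap

/-- The accessible set `{q ≠ 0}` is measurable for measurable `Φ`. [folklore] -/
theorem measurableSet_swappedDensity_ne_zero {Φ : Config (n + 1) → ℝ} (hΦ : Measurable Φ) :
    MeasurableSet {Z : Config (n + 1) × Config (n + 1) | swappedDensity Φ Z ≠ 0} :=
  measurable_swappedDensity hΦ (measurableSet_singleton 0).compl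

/-- The set `{p ≠ 0}` is measurable for measurable `Φ`. [folklore] -/
theorem measurableSet_replicaDensity_ne_zero {Φ : Config (n + 1) → ℝ} (hΦ : Measurable Φ) :
    MeasurableSet {Z : Config (n + 1) × Config (n + 1) | replicaDensity Φ Z ≠ 0} :=
  measurable_replicaDensity hΦ (measurableSet_singleton 0).compl

/-- The replica swap as a measurable equivalence: through
`(ℝ³)^{n+1} × (ℝ³)^{n+1} ≃ (Fin (n+1) ⊕ Fin (n+1) → ℝ³)` it is the coordinate permutation
`inl 0 ↔ inr 0`. [folklore] -/
def replicaSwapMEquiv : Config (n + 1) × Config (n + 1) ≃ᵐ Config (n + 1) × Config (n + 1) :=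
  ((MeasurableEquiv.sumPiEquivProdPi fun _ : Fin (n + 1) ⊕ Fin (n + 1) => Space).symm.trans
      (MeasurableEquiv.piCongrLeft (fun _ : Fin (n + 1) ⊕ Fin (n + 1) => Space)
        (Equiv.swap (Sum.inl 0) (Sum.inr 0)))).trans
    (MeasurableEquiv.sumPiEquivProdPi fun _ : Fin (n + 1) ⊕ Fin (n + 1) => Space)

/-- The measurable equivalence in coordinates: `(Z ∘ σ ∘ inl, Z ∘ σ ∘ inr)` for the transposition
`σ = (inl 0  inr 0)` acting on the juxtaposed configuration `Z = (X, Y)`. [folklore] -/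
theorem replicaSwapMEquiv_apply (Z : Config (n + 1) × Config (n + 1)) :
    replicaSwapMEquiv Z =
      (Sum.rec Z.1 Z.2 ∘ Equiv.swap (Sum.inl 0) (Sum.inr 0) ∘ Sum.inl,
        Sum.rec Z.1 Z.2 ∘ Equiv.swap (Sum.inl 0) (Sum.inr 0) ∘ Sum.inr) := by
  simp only [replicaSwapMEquiv, MeasurableEquiv.trans_apply, MeasurableEquiv.coe_sumPiEquivProdPi,
    MeasurableEquiv.coe_sumPiEquivProdPi_symm, MeasurableEquiv.coe_piCongrLeft]
  refine Prod.ext (funext fun i => ?_) (funext fun i => ?_) <;>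
    simp [Equiv.piCongrLeft_apply_eq_cast, Equiv.sumPiEquivProdPi]

/-- The measurable equivalence is the replica swap. [folklore] -/
theorem coe_replicaSwapMEquiv :
    ⇑(replicaSwapMEquiv (n := n)) = replicaSwap := by
  funext Z
  rw [replicaSwapMEquiv_apply]
  refine Prod.ext (funext fun i => ?_) (funext fun i => ?_)
  · rcases eq_or_ne i 0 with rfl | hi
    · simp [replicaSwap]
    · simp only [Function.comp_apply, replicaSwap_fst]
      rw [Equiv.swap_apply_of_ne_of_ne (by simpa using hi) Sum.inl_ne_inr, Function.update_of_ne hi]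
  · rcases eq_or_ne i 0 with rfl | hi
    · simp [replicaSwap]
    · simp only [Function.comp_apply, replicaSwap_snd]
      rw [Equiv.swap_apply_of_ne_of_ne Sum.inr_ne_inl (by simpa using hi), Function.update_of_ne hi]

/-- **The replica swap preserves Lebesgue measure** on `(ℝ³)^{n+1} × (ℝ³)^{n+1}` (a coordinate
permutation). [folklore] -/
theorem measurePreserving_replicaSwap :
    MeasurePreserving (replicaSwap : Config (n + 1) × Config (n + 1) → _) volume volume := by
  have h : MeasurePreserving (replicaSwapMEquiv (n := n)) volume volume :=
    ((volume_measurePreserving_sumPiEquivProdPi_symm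
          fun _ : Fin (n + 1) ⊕ Fin (n + 1) => Space).trans
      (volume_measurePreserving_piCongrLeft (fun _ : Fin (n + 1) ⊕ Fin (n + 1) => Space)
        (Equiv.swap (Sum.inl 0) (Sum.inr 0)))).trans
      (volume_measurePreserving_sumPiEquivProdPi fun _ : Fin (n + 1) ⊕ Fin (n + 1) => Space)
  rwa [coe_replicaSwapMEquiv] at h

/-- Change of variables under the swap: `∫ G (T Z) dZ = ∫ G dZ` for every `G ≥ 0`. [folklore] -/
theorem lintegral_comp_replicaSwap (G : Config (n + 1) × Config (n + 1) → ℝ≥0∞) :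
    ∫⁻ Z, G (replicaSwap Z) = ∫⁻ Z, G Z := by
  have h := (measurePreserving_replicaSwap (n := n)).lintegral_comp_emb
    (coe_replicaSwapMEquiv (n := n) ▸ (replicaSwapMEquiv (n := n)).measurableEmbedding) G
  simpa using h

/-- `∫ q = ∫ p`: the swapped density has the same total mass. [folklore] -/
theorem lintegral_swappedDensity (Φ : Config (n + 1) → ℝ) :
    ∫⁻ Z, ENNReal.ofReal (swappedDensity Φ Z) = ∫⁻ Z, ENNReal.ofReal (replicaDensity Φ Z) :=
  lintegral_comp_replicaSwap fun Z => ENNReal.ofReal (replicaDensity Φ Z)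

/-! ### Total mass and the bound `swapMass ≤ (∫ Φ²)² ≤ 1` -/

/-- `ofReal (x²) = ‖(x : ℂ)‖₊²` in `ℝ≥0∞` (the route's `L²` currency for real `Φ`). [folklore] -/
theorem ofReal_sq_eq_coe_nnnorm_sq (x : ℝ) :
    ENNReal.ofReal (x ^ 2) = (‖(x : ℂ)‖₊ : ℝ≥0∞) ^ 2 := by
  rw [Complex.nnnorm_real, ← sq_abs, ENNReal.ofReal_pow (abs_nonneg x), ← Real.norm_eq_abs,
    ofReal_norm, enorm_eq_nnnorm]

/-- `ofReal x = ‖(x : ℂ)‖₊` in `ℝ≥0∞` for `x ≥ 0`. [folklore] -/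
theorem coe_nnnorm_ofReal_of_nonneg {x : ℝ} (hx : 0 ≤ x) :
    (‖(x : ℂ)‖₊ : ℝ≥0∞) = ENNReal.ofReal x := by
  rw [Complex.nnnorm_real, ← enorm_eq_nnnorm, Real.enorm_eq_ofReal hx]

/-- `∫ ofReal (Φ²) = ∫ ‖(Φ : ℂ)‖₊²`. [folklore] -/
theorem lintegral_ofReal_sq_eq (Φ : Config (n + 1) → ℝ) :
    ∫⁻ X, ENNReal.ofReal (Φ X ^ 2) = ∫⁻ X, (‖(Φ X : ℂ)‖₊ : ℝ≥0∞) ^ 2 :=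
  lintegral_congr fun X => ofReal_sq_eq_coe_nnnorm_sq (Φ X)

/-- `∫∫ p = (∫ Φ²)²` (Tonelli). [folklore] -/
theorem lintegral_replicaDensity {Φ : Config (n + 1) → ℝ} (hΦ : Measurable Φ) :
    ∫⁻ Z, ENNReal.ofReal (replicaDensity Φ Z) = (∫⁻ X, ENNReal.ofReal (Φ X ^ 2)) ^ 2 := by
  have hm : AEMeasurable (fun X => ENNReal.ofReal (Φ X ^ 2)) volume :=
    (hΦ.pow_const 2).ennreal_ofReal.aemeasurable
  simp_rw [replicaDensity, ENNReal.ofReal_mul (sq_nonneg _)]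
  rw [Measure.volume_eq_prod, lintegral_prod_mul hm hm, sq]

/-- `swapMass ≤ ∫∫ p`. [folklore] -/
theorem swapMass_le_lintegral_replicaDensity (Φ : Config (n + 1) → ℝ) :
    swapMass n Φ ≤ ∫⁻ Z, ENNReal.ofReal (replicaDensity Φ Z) :=
  setLIntegral_le_lintegral _ _

/-- **`swapMass ≤ (∫ Φ²)²`.** [folklore] -/
theorem swapMass_le {Φ : Config (n + 1) → ℝ} (hΦ : Measurable Φ) :
    swapMass n Φ ≤ (∫⁻ X, ENNReal.ofReal (Φ X ^ 2)) ^ 2 :=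
  (swapMass_le_lintegral_replicaDensity Φ).trans (lintegral_replicaDensity hΦ).le

/-- **`swapMass ≤ 1` for (sub)normalised `Φ`** (`∫ Φ² ≤ 1`, in the route's currency
`∫ ‖(Φ : ℂ)‖₊² ≤ 1`). [folklore] -/
theorem swapMass_le_one {Φ : Config (n + 1) → ℝ} (hΦ : Measurable Φ)
    (h1 : ∫⁻ X, (‖(Φ X : ℂ)‖₊ : ℝ≥0∞) ^ 2 ≤ 1) : swapMass n Φ ≤ 1 := by
  refine (swapMass_le hΦ).trans ?_
  rw [lintegral_ofReal_sq_eq]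
  simpa using pow_le_one₀ zero_le h1

/-! ### `q = p`: product states -/

/-- If `q = p` then the accessible swap mass is the total mass `∫∫ p`. [folklore] -/
theorem swapMass_eq_lintegral_of_swappedDensity_eq {Φ : Config (n + 1) → ℝ}
    (h : swappedDensity Φ = replicaDensity Φ) :
    swapMass n Φ = ∫⁻ Z, ENNReal.ofReal (replicaDensity Φ Z) := by
  rw [swapMass, h]
  refine setLIntegral_eq_of_support_subset fun Z hZ => ?_
  intro h0
  apply hZ
  simp only [h0, ENNReal.ofReal_zero]

/-- If `q = p` then the swap relative entropy vanishes. [folklore] -/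
theorem swapEntropy_eq_zero_of_swappedDensity_eq {Φ : Config (n + 1) → ℝ}
    (h : swappedDensity Φ = replicaDensity Φ) : swapEntropy n Φ = 0 := by
  simp [swapEntropy, h]

/-- A Hartree product `Φ(X) = ∏ᵢ φ(xᵢ)` at a configuration with particle `0` replaced.
[folklore] -/
theorem prod_update_zero (φ : Space → ℝ) (X : Config (n + 1)) (y : Space) :
    ∏ i, φ (Function.update X 0 y i) = φ y * ∏ i : Fin n, φ (X i.succ) := by
  rw [Fin.prod_univ_succ]
  simp

/-- **Product states have `q = p`**: for a Hartree product `Φ(X) = ∏ᵢ φ(xᵢ)` exchanging particle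
`0` between the replicas does not change the two-replica density. [folklore] -/
theorem swappedDensity_prod (φ : Space → ℝ) :
    swappedDensity (fun X : Config (n + 1) => ∏ i, φ (X i)) =
      replicaDensity (fun X : Config (n + 1) => ∏ i, φ (X i)) := by
  funext Z
  simp only [swappedDensity, replicaDensity, prod_update_zero]
  rw [Fin.prod_univ_succ (fun i => φ (Z.1 i)), Fin.prod_univ_succ (fun i => φ (Z.2 i))]
  ring

/-- Product states have zero swap relative entropy. [folklore] -/
theorem swapEntropy_prod (φ : Space → ℝ) :
    swapEntropy n (fun X : Config (n + 1) => ∏ i, φ (X i)) = 0 :=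
  swapEntropy_eq_zero_of_swappedDensity_eq (swappedDensity_prod φ)

/-- Product states have accessible swap mass `∫∫ p`. [folklore] -/
theorem swapMass_prod (φ : Space → ℝ) :
    swapMass n (fun X : Config (n + 1) => ∏ i, φ (X i)) =
      ∫⁻ Z, ENNReal.ofReal (replicaDensity (fun X : Config (n + 1) => ∏ i, φ (X i)) Z) :=
  swapMass_eq_lintegral_of_swappedDensity_eq (swappedDensity_prod φ)

/-! ### The entropy integrand and the Bhattacharyya form of the swap purity -/

/-- `swapEntropy = ∫_{q ≠ 0} p · (log p − log q)⁺` (as `p ≥ 0`, `ofReal (p·f) = ofReal p · ofReal f`).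
[folklore] -/
theorem swapEntropy_eq_lintegral_mul (Φ : Config (n + 1) → ℝ) :
    swapEntropy n Φ = ∫⁻ Z in {Z | swappedDensity Φ Z ≠ 0},
      ENNReal.ofReal (replicaDensity Φ Z) *
        ENNReal.ofReal (Real.log (replicaDensity Φ Z) - Real.log (swappedDensity Φ Z)) := by
  simp_rw [swapEntropy, ENNReal.ofReal_mul (replicaDensity_nonneg _ _)]

/-- `√(p q) = Φ(X) Φ(Y) Φ(X[0 ↦ y₀]) Φ(Y[0 ↦ x₀])` for `Φ ≥ 0`. [folklore] -/
theorem sqrt_replicaDensity_mul_swappedDensity {Φ : Config (n + 1) → ℝ} (h0 : ∀ X, 0 ≤ Φ X)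
    (Z : Config (n + 1) × Config (n + 1)) :
    Real.sqrt (replicaDensity Φ Z * swappedDensity Φ Z) =
      Φ Z.1 * Φ Z.2 * Φ (Function.update Z.1 0 (Z.2 0)) * Φ (Function.update Z.2 0 (Z.1 0)) := by
  rw [show replicaDensity Φ Z * swappedDensity Φ Z =
      (Φ Z.1 * Φ Z.2 * Φ (Function.update Z.1 0 (Z.2 0)) * Φ (Function.update Z.2 0 (Z.1 0))) ^ 2 by
    simp only [replicaDensity, swappedDensity]; ring]
  exact Real.sqrt_sq (mul_nonneg (mul_nonneg (mul_nonneg (h0 _) (h0 _)) (h0 _)) (h0 _))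

/-- **Bhattacharyya form of the swap purity**: for measurable `Φ ≥ 0` in `L²`,
`swapPurity n Φ = ∫ √(p q) d(X, Y)` — `tr(γ_Φ²)/N²` is the Bhattacharyya affinity of the two-replica
density and its image under the exchange of particle `0` (from `swapPurity_eq_lintegral_of_nonneg`).
[cite: HerdmanEtAl2014, eq. (1) (n = 1, real nonnegative Ψ)] -/
theorem swapPurity_ofReal_eq_lintegral_sqrt {Φ : Config (n + 1) → ℝ} (hΦ : Measurable Φ)
    (h0 : ∀ X, 0 ≤ Φ X) (hfin : ∫⁻ X, (‖(Φ X : ℂ)‖₊ : ℝ≥0∞) ^ 2 ≠ ⊤) :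
    swapPurity n (fun X => (Φ X : ℂ)) =
      ∫⁻ Z, ENNReal.ofReal (Real.sqrt (replicaDensity Φ Z * swappedDensity Φ Z)) := by
  have hreal : ∀ Z : Config (n + 1), (Φ Z : ℂ) = (‖(Φ Z : ℂ)‖ : ℂ) := fun Z => by
    rw [Complex.norm_real, Real.norm_eq_abs, abs_of_nonneg (h0 Z)]
  have hΨ : Measurable fun X => (Φ X : ℂ) := Complex.measurable_ofReal.comp hΦ
  rw [swapPurity_eq_lintegral_of_nonneg hΨ hreal hfin]
  refine lintegral_congr fun Z => ?_
  rw [sqrt_replicaDensity_mul_swappedDensity h0, ENNReal.ofReal_mul (mul_nonneg (mul_nonneg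
      (h0 _) (h0 _)) (h0 _)), ENNReal.ofReal_mul (mul_nonneg (h0 _) (h0 _)),
    ENNReal.ofReal_mul (h0 _), coe_nnnorm_ofReal_of_nonneg (h0 _),
    coe_nnnorm_ofReal_of_nonneg (h0 _), coe_nnnorm_ofReal_of_nonneg (h0 _),
    coe_nnnorm_ofReal_of_nonneg (h0 _)]

/-- The Bhattacharyya integrand vanishes off the accessible set, so the affinity may be computed
on `{q ≠ 0}`: `∫ √(p q) = ∫_{q ≠ 0} √(p q)`. [folklore] -/
theorem setLIntegral_sqrt_replicaDensity_mul_swappedDensity (Φ : Config (n + 1) → ℝ) :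
    ∫⁻ Z in {Z | swappedDensity Φ Z ≠ 0},
        ENNReal.ofReal (Real.sqrt (replicaDensity Φ Z * swappedDensity Φ Z)) =
      ∫⁻ Z, ENNReal.ofReal (Real.sqrt (replicaDensity Φ Z * swappedDensity Φ Z)) := by
  refine setLIntegral_eq_of_support_subset fun Z hZ => ?_
  intro h0
  apply hZ
  simp only [h0, mul_zero, Real.sqrt_zero, ENNReal.ofReal_zero]

/-- **Bhattacharyya form on the accessible set**: for measurable `Φ ≥ 0` in `L²`,
`swapPurity n Φ = ∫_{q ≠ 0} √(p q)`. [cite: HerdmanEtAl2014, eq. (1) (n = 1, real nonnegative Ψ)] -/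
theorem swapPurity_ofReal_eq_setLIntegral_sqrt {Φ : Config (n + 1) → ℝ} (hΦ : Measurable Φ)
    (h0 : ∀ X, 0 ≤ Φ X) (hfin : ∫⁻ X, (‖(Φ X : ℂ)‖₊ : ℝ≥0∞) ^ 2 ≠ ⊤) :
    swapPurity n (fun X => (Φ X : ℂ)) = ∫⁻ Z in {Z | swappedDensity Φ Z ≠ 0},
      ENNReal.ofReal (Real.sqrt (replicaDensity Φ Z * swappedDensity Φ Z)) := by
  rw [swapPurity_ofReal_eq_lintegral_sqrt hΦ h0 hfin,
    setLIntegral_sqrt_replicaDensity_mul_swappedDensity]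

end Literature.MathematicalPhysics.QuantumManyBody.BoseGas

end
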